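import Literature.NumberTheory.PAdicHodge.BdRPlusLogOneAdd
import Literature.NumberTheory.PAdicHodge.AlgClosureToBdR
import HarnessLib

/-!
# The `B_dR⁺`-integral of the Kummer cocycle of a unit: `ℓ_u = log([ũ]·u⁻¹) ∈ Fil¹`, `(σ − 1) ℓ_u = a·t` when `σ♭ ũ = ε^a ũ`

Topic `Literature/NumberTheory/PAdicHodge`; namespace `Literature.NumberTheory.PAdicHodge.BdRPlusTop`. The `𝔾_m`-twin of
the tree's `AinfWeierstrassKummerIntegral` (the ω-integrating element of the Kummer cocycle of a point of `Ŵ`), i.e.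
Bloch–Kato's Example 3.10.1 for `ℚ_p(1)` (the Kummer map `K̂ˣ → H¹(K, ℚ_p(1))` IS the Bloch–Kato exponential of `𝔾_m`)
at the level of COCYCLES and `B_dR⁺`-COCHAINS, with no use of `B_crys`:

For a `p`-adic field `F`, a nonzero `u ∈ F̄` and a `p`-power root system `ũ = (u^{1/pⁿ} mod p)_n ∈ 𝒪_{ℂ_F}♭` of `u`
(`untilt ũ = u`, §1: `rootTilt`, every `u` with `|u| ≤ 1` has one), Fontaine's product `[ũ]·ι(u⁻¹) ∈ B_dR⁺(F)` (`ι : F̄ → B_dR⁺`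
the tree's `algClosureToBdR`) lies in `1 + Fil¹` (`θ[ũ] = u`), so

  **`ℓ(ũ, u) := log([ũ]·ι(u)⁻¹) ∈ Fil¹ B_dR⁺(F)`**   (`kummerUnitLog`, via `BdRPlusTop.logOneAdd`)

is defined; and for `σ ∈ Γ_F` FIXING `u` and acting on the root system through `σ♭(ũ) = ε^a · ũ` (`a ∈ ℤ_p` — by definition
the value at `σ` of the Kummer cocycle of `u` relative to Fontaine's `ε`):

  **`σ(ℓ(ũ, u)) = ℓ(ũ, u) + a · t`**   (`gal_kummerUnitLog`; `t = log[ε]` the tree's `tBdR`),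

by `σ([ũ] ι(u⁻¹)) = [ε^a]·[ũ] ι(u⁻¹)`, additivity of the logarithm on `1 + Fil¹` and `log[ε^a] = a·t`
(`BdRPlusLogOneAdd`). In words: the `ℤ_p(1)`-valued Kummer cocycle `σ ↦ a(σ)·t` of `u` is the coboundary of `ℓ(ũ,u)` in
`Fil¹B_dR⁺`, i.e. the Kummer class of every unit DIES in `H¹(F, Fil¹B_dR⁺) = H¹(F, B_dR⁺(1))` with an EXPLICIT integrating
element — the input of Kato's Lemma II.1.4.4 (`δ(a · log χ) = exp(a) ∪ log χ`) in `B_dR⁺`-currency, and the twist-one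
companion of `H¹_e(ℚ_p(1)) = 𝒪_Fˣ ⊗ ℚ_p` (Bloch–Kato Ex. 3.9 / 3.10.1). `ℓ(ũ,u)` differs from Fontaine's `log[ũ]` (which
does not converge `ξ`-adically) by the `Γ_F`-invariant constant `log u ∈ F`, exactly as `b_ω` differs from `∫_{Q̃} ω` by
`log_ω(P)` on the elliptic side.

* §1 root systems: `rootSeq u n` (`u_{n+1}^p = u_n`, `u_0 = u`), `rootTilt u ∈ 𝒪_{ℂ_F}♭` with `untilt (rootTilt u) = u`;
* §2 `kummerUnitElt ũ u = [ũ]·ι(u⁻¹)`, `θ = 1`, membership in `1 + Fil¹`, and its `Γ_F`-transformation;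
* §3 `kummerUnitLog` and the main law `gal_kummerUnitLog`.

Crux K★ `stmt-BirchSwinnertonDyer-22226` (route EdixhovenFibreFiveSeven, line `kato_lever`): floor (a)/(d) infrastructure of
the [REC] programme (`Cruxes/StarredOptimalManinUnitFiveSeven/Lines/kato-lever-K3-programme.md`). Definitions (reviewed):
`rootSeq`, `rootC`, `rootTilt`, `kummerUnitElt`, `kummerUnitLog`. No named fact, no instance, no `sorry`. BSD / K★ are not
proved by any of this.

## References
* S. Bloch, K. Kato, *L-functions and Tamagawa numbers of motives* (1990), Ex. 3.9, Def. 3.10, Ex. 3.10.1. [BlochKato1990]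
* K. Kato, LNM 1553 (1993), Ch. II §1.4.4–Lemma 1.4.5. [Kato1993LNM1553]
* J.-M. Fontaine, *Le corps des périodes p-adiques*, Astérisque 223 (1994), Exp. II §1.2.2, §1.5.4. [FontaineAsterisque223III]
-/

noncomputable section

open Ideal Field WittVector ValuativeRel

namespace Literature.NumberTheory.PAdicHodge

namespace BdRPlusTop

open Literature.NumberTheory.GaloisRepresentations
open Literature.NumberTheory.GaloisRepresentations.IsNonarchimedeanLocalField
open Literature.NumberTheory.GaloisRepresentations.LubinTate

variable {F : Type} [Field F] [ValuativeRel F] [TopologicalSpace F] [IsNonarchimedeanLocalField F]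
  {p : ℕ} [Fact p.Prime]

/-! ## §1 `p`-power root systems in `F̄` and their tilts -/

variable (p) in
/-- **A `p`-power root system of `u ∈ F̄`**: `u_0 = u`, `u_{n+1}` a chosen `p`-th root of `u_n` (`F̄` algebraically closed).
[cite: FontaineAsterisque223III, Exp. II §1.2.2] -/
def rootSeq (u : NormedAlgClosure F) : ℕ → NormedAlgClosure F
  | 0 => u
  | n + 1 => Classical.choose (IsAlgClosed.exists_pow_nat_eq (rootSeq u n) (Fact.out : p.Prime).pos)

/-- `rootSeq u 0 = u`. [cite: FontaineAsterisque223III, Exp. II §1.2.2] -/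
@[simp] theorem rootSeq_zero (u : NormedAlgClosure F) : rootSeq p u 0 = u := rfl

/-- `(u_{n+1})^p = u_n`. [cite: FontaineAsterisque223III, Exp. II §1.2.2] -/
theorem rootSeq_succ_pow (u : NormedAlgClosure F) (n : ℕ) : rootSeq p u (n + 1) ^ p = rootSeq p u n :=
  Classical.choose_spec (IsAlgClosed.exists_pow_nat_eq (rootSeq p u n) (Fact.out : p.Prime).pos)

/-- `(u_n)^(pⁿ) = u`. [cite: FontaineAsterisque223III, Exp. II §1.2.2] -/
theorem rootSeq_pow (u : NormedAlgClosure F) (n : ℕ) : rootSeq p u n ^ p ^ n = u := by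
  induction n with
  | zero => rw [pow_zero, pow_one, rootSeq_zero]
  | succ n ih => rw [pow_succ', pow_mul, rootSeq_succ_pow, ih]

/-- `‖u_n‖ ≤ 1` when `‖u‖ ≤ 1`. [cite: FontaineAsterisque223III, Exp. II §1.2.2] -/
theorem norm_rootSeq_le (u : NormedAlgClosure F) (hu : ‖u‖ ≤ 1) (n : ℕ) : ‖rootSeq p u n‖ ≤ 1 := by
  have h : ‖rootSeq p u n‖ ^ p ^ n ≤ 1 := by rw [← norm_pow, rootSeq_pow]; exact hu
  exact (pow_le_one_iff_of_nonneg (norm_nonneg _) (pow_ne_zero n (Fact.out : p.Prime).ne_zero)).1 h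

variable (p) in
/-- The root system read in `𝒪_{ℂ_F}` (for `‖u‖ ≤ 1`). [cite: FontaineAsterisque223III, Exp. II §1.2.2] -/
def rootC (u : NormedAlgClosure F) (hu : ‖u‖ ≤ 1) (n : ℕ) : integerC F :=
  ⟨((rootSeq p u n : NormedAlgClosure F) : CompletedAlgClosure F), by
    rw [mem_integerC_iff, UniformSpace.Completion.norm_coe]; exact norm_rootSeq_le u hu n⟩

/-- `rootC u (n+1)^p = rootC u n`. [cite: FontaineAsterisque223III, Exp. II §1.2.2] -/
theorem rootC_succ_pow (u : NormedAlgClosure F) (hu : ‖u‖ ≤ 1) (n : ℕ) : rootC p u hu (n + 1) ^ p = rootC p u hu n := by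
  refine Subtype.ext ?_
  rw [SubmonoidClass.coe_pow]
  change (UniformSpace.Completion.coeRingHom : NormedAlgClosure F →+* CompletedAlgClosure F) (rootSeq p u (n + 1)) ^ p =
    (UniformSpace.Completion.coeRingHom : NormedAlgClosure F →+* CompletedAlgClosure F) (rootSeq p u n)
  rw [← map_pow, rootSeq_succ_pow]

/-- `rootC u n ^ pⁿ = u` in `𝒪_{ℂ_F}`. [cite: FontaineAsterisque223III, Exp. II §1.2.2] -/
theorem rootC_pow (u : NormedAlgClosure F) (hu : ‖u‖ ≤ 1) (n : ℕ) : rootC p u hu n ^ p ^ n = rootC p u hu 0 := by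
  refine Subtype.ext ?_
  rw [SubmonoidClass.coe_pow]
  change (UniformSpace.Completion.coeRingHom : NormedAlgClosure F →+* CompletedAlgClosure F) (rootSeq p u n) ^ p ^ n =
    (UniformSpace.Completion.coeRingHom : NormedAlgClosure F →+* CompletedAlgClosure F) (rootSeq p u 0)
  rw [← map_pow, rootSeq_pow, rootSeq_zero]

variable [Fact (¬ IsUnit (p : integerC F))]

variable (p) in
/-- **The tilt `ũ = (u_n mod p)_n ∈ 𝒪_{ℂ_F}♭` of the root system** (Fontaine's element of `R = lim 𝒪/p`).
[cite: FontaineAsterisque223III, Exp. II §1.2.2] -/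
def rootTilt (u : NormedAlgClosure F) (hu : ‖u‖ ≤ 1) : PreTilt (integerC F) p :=
  ⟨fun n => Ideal.Quotient.mk _ (rootC p u hu n), fun n => by rw [← map_pow, rootC_succ_pow]⟩

/-- Coefficients of `ũ`. [cite: FontaineAsterisque223III, Exp. II §1.2.2] -/
@[simp] theorem coeff_rootTilt (u : NormedAlgClosure F) (hu : ‖u‖ ≤ 1) (n : ℕ) :
    PreTilt.coeff n (rootTilt p u hu) = Ideal.Quotient.mk _ (rootC p u hu n) := rfl

variable [IsAdicComplete (Ideal.span {(p : integerC F)}) (integerC F)]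

/-- **`ũ♯ = u`**: the untilt of the root system is `u` (the sharp map is `lim u_n^{pⁿ}`).
[cite: FontaineAsterisque223III, Exp. II §1.2.2] -/
theorem untilt_rootTilt (u : NormedAlgClosure F) (hu : ‖u‖ ≤ 1) : PreTilt.untilt (rootTilt p u hu) = rootC p u hu 0 := by
  change Perfection.teichmuller p (Ideal.span {(p : integerC F)}) (rootTilt p u hu) = _
  refine Perfection.teichmuller_spec fun n => ⟨rootC p u hu n, rfl, ?_⟩
  rw [rootC_pow]
  exact SModEq.refl (M := integerC F) _

/-- `ũ♯ = u` read in `ℂ_F`. [cite: FontaineAsterisque223III, Exp. II §1.2.2] -/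
theorem coe_untilt_rootTilt (u : NormedAlgClosure F) (hu : ‖u‖ ≤ 1) :
    ((PreTilt.untilt (rootTilt p u hu) : integerC F) : CompletedAlgClosure F) = (u : CompletedAlgClosure F) := by
  rw [untilt_rootTilt]; rfl

/-! ## §2 Fontaine's element `[ũ]·ι(u⁻¹) ∈ 1 + Fil¹ B_dR⁺` -/

variable [CharZero F] (hp : valuation F p < 1) (hF : Function.Surjective (fontaineTheta (integerC F) p))

/-- **`z(ũ, u) := [ũ] · ι(u⁻¹) ∈ B_dR⁺(F)`** for a nonzero `u ∈ F̄` and ANY `ũ ∈ 𝒪_{ℂ_F}♭` (meant: `ũ♯ = u`), where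
`ι = algClosureToBdR : F̄ → B_dR⁺` is the tree's `Γ_F`-equivariant section of `θ` on `F̄`. [cite: FontaineAsterisque223III, Exp. II §1.5.4]
[cite: BlochKato1990, Ex. 3.10.1] -/
def kummerUnitElt (v : PreTilt (integerC F) p) (u : NormedAlgClosure F) : BdRPlusTop F p :=
  of F p (ainfToBdR (teichmuller p v) * algClosureToBdR hp hF (NormedAlgClosure.toAlgClosure u⁻¹))

/-- **`θ(z(ũ, u)) = ũ♯ · u⁻¹ = 1`** when `ũ♯ = u ≠ 0`. [cite: FontaineAsterisque223III, Exp. II §1.5.4] -/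
theorem thetaBdR_kummerUnitElt {v : PreTilt (integerC F) p} {u : NormedAlgClosure F} (hu : u ≠ 0)
    (hv : ((PreTilt.untilt v : integerC F) : CompletedAlgClosure F) = (u : CompletedAlgClosure F)) :
    thetaBdR ((of F p).symm (kummerUnitElt hp hF v u)) = 1 := by
  rw [kummerUnitElt, RingEquiv.symm_apply_apply, map_mul, thetaBdR_ainfToBdR, fontaineTheta_teichmuller, hv,
    thetaBdR_algClosureToBdR, algClosureToC_apply]
  change (u : CompletedAlgClosure F) * ((u⁻¹ : NormedAlgClosure F) : CompletedAlgClosure F) = 1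
  rw [← UniformSpace.Completion.coe_mul, mul_inv_cancel₀ hu, UniformSpace.Completion.coe_one]

/-- **`z(ũ, u) ∈ 1 + Fil¹`**: `z(ũ,u) − 1 ∈ (ξ_dR) = ker θ`. [cite: FontaineAsterisque223III, Exp. II §1.5.4] -/
theorem kummerUnitElt_sub_one_mem_filOne {v : PreTilt (integerC F) p} {u : NormedAlgClosure F} (hu : u ≠ 0)
    (hv : ((PreTilt.untilt v : integerC F) : CompletedAlgClosure F) = (u : CompletedAlgClosure F)) :
    kummerUnitElt hp hF v u - 1 ∈ (filOne F p).toIdeal := by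
  rw [mem_filOne_iff, map_sub, map_one, ← mem_ker_thetaBdR_iff, map_sub, map_one, thetaBdR_kummerUnitElt hp hF hu hv,
    sub_self]

/-- **`Γ_F` on `z(ũ, u)`**: if `σ` fixes `u` and `σ♭(ũ) = e · ũ` in `𝒪_{ℂ_F}♭`, then `σ(z) = [e] · z`.
[cite: FontaineAsterisque223III, Exp. II §1.5.4] -/
theorem gal_kummerUnitElt_of_galTilt (σ : absoluteGaloisGroup F) {v e : PreTilt (integerC F) p} {u : NormedAlgClosure F}
    (hσv : galTilt σ v = e * v) (hσu : σ • u = u) :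
    gal F p σ (kummerUnitElt hp hF v u) = ofAinf F p (teichmuller p e) * kummerUnitElt hp hF v u := by
  rw [kummerUnitElt, gal_of, map_mul, galBdRPlus_ainfToBdR, galAinf_teichmuller, hσv, map_mul, map_mul,
    galBdRPlus_algClosureToBdR, ← NormedAlgClosure.toAlgClosure_smul, smul_inv'', hσu, map_mul, map_mul, mul_assoc]
  rfl

/-- **`σ(z) = [ε^a] · z`** when `σ` fixes `u` and `σ♭(ũ) = ε^a · ũ` (`a ∈ ℤ_p` the Kummer exponent of `σ` on the root system).
[cite: FontaineAsterisque223III, Exp. II §1.5.4] [cite: BlochKato1990, Ex. 3.10.1] -/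
theorem gal_kummerUnitElt (σ : absoluteGaloisGroup F) {v : PreTilt (integerC F) p} {u : NormedAlgClosure F} (a : ℤ_[p])
    (hσv : galTilt σ v = epsPow a * v) (hσu : σ • u = u) :
    gal F p σ (kummerUnitElt hp hF v u) =
      ofAinf F p (teichmuller p (epsPow a : PreTilt (integerC F) p)) * kummerUnitElt hp hF v u :=
  gal_kummerUnitElt_of_galTilt hp hF σ hσv hσu

/-! ## §3 `ℓ(ũ, u) = log([ũ]·ι(u⁻¹))` and `σ(ℓ) = ℓ + a·t` -/

/-- **`ℓ(ũ, u) := log([ũ]·ι(u⁻¹)) ∈ Fil¹ B_dR⁺(F)`** — the `B_dR⁺`-INTEGRAL of the Kummer cocycle of `u` (Fontaine's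
`log[ũ]` corrected by the invariant constant `log u`, so that the series converges `ξ`-adically). [cite: BlochKato1990, Ex. 3.10.1]
[cite: FontaineAsterisque223III, Exp. II §1.5.4] [cite: Kato1993LNM1553, Ch. II §1.4.4] -/
def kummerUnitLog (v : PreTilt (integerC F) p) (u : NormedAlgClosure F) (hu : u ≠ 0)
    (hv : ((PreTilt.untilt v : integerC F) : CompletedAlgClosure F) = (u : CompletedAlgClosure F)) : (filOne F p).toIdeal :=
  logOneAdd ⟨kummerUnitElt hp hF v u - 1, kummerUnitElt_sub_one_mem_filOne hp hF hu hv⟩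

/-- `ℓ(ũ, u) ∈ Fil¹`. [cite: FontaineAsterisque223III, Exp. II §1.5.4] -/
theorem kummerUnitLog_mem_filOne (v : PreTilt (integerC F) p) (u : NormedAlgClosure F) (hu : u ≠ 0)
    (hv : ((PreTilt.untilt v : integerC F) : CompletedAlgClosure F) = (u : CompletedAlgClosure F)) :
    (kummerUnitLog hp hF v u hu hv : BdRPlusTop F p) ∈ (filOne F p).toIdeal :=
  (kummerUnitLog hp hF v u hu hv).2

/-- **The transformation law in the `e`-form**: if `σ` fixes `u` and `σ♭(ũ) = e·ũ` with `θ[e] = 1` (automatic: `e♯ = σ(u)/u`),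
then `σ(ℓ(ũ,u)) = ℓ(ũ,u) + log[e]`. [cite: FontaineAsterisque223III, Exp. II §1.5.4] [cite: BlochKato1990, Ex. 3.10.1] -/
theorem gal_kummerUnitLog_of_galTilt (σ : absoluteGaloisGroup F) {v e : PreTilt (integerC F) p} {u : NormedAlgClosure F}
    (hu : u ≠ 0) (hv : ((PreTilt.untilt v : integerC F) : CompletedAlgClosure F) = (u : CompletedAlgClosure F))
    (hσv : galTilt σ v = e * v) (hσu : σ • u = u) (he : ofAinf F p (teichmuller p e) - 1 ∈ (filOne F p).toIdeal) :
    gal F p σ (kummerUnitLog hp hF v u hu hv : BdRPlusTop F p) =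
      kummerUnitLog hp hF v u hu hv + logOneAdd ⟨ofAinf F p (teichmuller p e) - 1, he⟩ := by
  rw [kummerUnitLog, gal_logOneAdd]
  have hz := kummerUnitElt_sub_one_mem_filOne hp hF hu hv
  rw [logOneAdd_congr (y := ⟨ofAinf F p (teichmuller p e) * kummerUnitElt hp hF v u - 1, mul_sub_one_mem_filOne he hz⟩)
    (by show gal F p σ (kummerUnitElt hp hF v u - 1) = ofAinf F p (teichmuller p e) * kummerUnitElt hp hF v u - 1
        rw [map_sub, map_one, gal_kummerUnitElt_of_galTilt hp hF σ hσv hσu]),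
    logOneAdd_mul_sub_one he hz, add_comm]

/-- **MAIN — `σ(ℓ(ũ, u)) = ℓ(ũ, u) + a · t`**: for `σ ∈ Γ_F` fixing `u` with `σ♭(ũ) = ε^a · ũ` (`a = κ_u(σ) ∈ ℤ_p`, the Kummer
cocycle of `u` in the basis `ε` of `ℤ_p(1)`), the `B_dR⁺`-integral `ℓ(ũ,u)` of §3 satisfies `(σ − 1) ℓ(ũ,u) = a · t` with
`t = log[ε]` (tree `tBdR`): the `ℤ_p(1) ⊗ B_dR⁺ ≅ t B_dR⁺`-valued Kummer cocycle of a unit is an explicit coboundary in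
`Fil¹ B_dR⁺` — Bloch–Kato Ex. 3.10.1 (`Kummer = exp` for `𝔾_m`) at the cochain level, the input of Kato II §1.4.4.
[cite: BlochKato1990, Ex. 3.10.1] [cite: Kato1993LNM1553, Ch. II §1.4.4] [cite: FontaineAsterisque223III, Exp. II §1.5.4] -/
theorem gal_kummerUnitLog (σ : absoluteGaloisGroup F) {v : PreTilt (integerC F) p} {u : NormedAlgClosure F}
    (hu : u ≠ 0) (hv : ((PreTilt.untilt v : integerC F) : CompletedAlgClosure F) = (u : CompletedAlgClosure F))
    (a : ℤ_[p]) (hσv : galTilt σ v = epsPow a * v) (hσu : σ • u = u) :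
    gal F p σ (kummerUnitLog hp hF v u hu hv : BdRPlusTop F p) =
      kummerUnitLog hp hF v u hu hv + of F p (qpToBdR (a : ℚ_[p]) * tBdR) := by
  rw [gal_kummerUnitLog_of_galTilt hp hF σ hu hv hσv hσu (ofAinf_teichmuller_epsPow_sub_one_mem_filOne a),
    logOneAdd_teichmuller_epsPow]

/-- **The law for a unit `u ∈ F̄` with `|u| ≤ 1` and ITS root system `ũ = rootTilt u`**: `σ(ℓ_u) = ℓ_u + a·t` whenever `σ` fixes
`u` and `σ♭ ũ = ε^a ũ`. [cite: BlochKato1990, Ex. 3.10.1] [cite: Kato1993LNM1553, Ch. II §1.4.4] -/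
theorem gal_kummerUnitLog_rootTilt (σ : absoluteGaloisGroup F) {u : NormedAlgClosure F} (hu : u ≠ 0) (hu1 : ‖u‖ ≤ 1)
    (a : ℤ_[p]) (hσv : galTilt σ (rootTilt p u hu1) = epsPow a * rootTilt p u hu1) (hσu : σ • u = u) :
    gal F p σ (kummerUnitLog hp hF (rootTilt p u hu1) u hu (coe_untilt_rootTilt u hu1) : BdRPlusTop F p) =
      kummerUnitLog hp hF (rootTilt p u hu1) u hu (coe_untilt_rootTilt u hu1) + of F p (qpToBdR (a : ℚ_[p]) * tBdR) :=
  gal_kummerUnitLog hp hF σ hu (coe_untilt_rootTilt u hu1) a hσv hσu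


/-! ## §4 The Kummer exponent `a(σ) ∈ ℤ_p`: `σ♭ ũ = ε^{a(σ)} · ũ` for every `σ` fixing `u` -/

section Exponent

variable {u : NormedAlgClosure F}

omit [Fact (¬ IsUnit (p : integerC F))] [IsAdicComplete (Ideal.span {(p : integerC F)}) (integerC F)] [CharZero F] in
/-- `u_n ≠ 0` for `u ≠ 0`. [cite: FontaineAsterisque223III, Exp. II §1.2.2] -/
theorem rootSeq_ne_zero (hu : u ≠ 0) (n : ℕ) : rootSeq p u n ≠ 0 := fun h =>
  hu (by rw [← rootSeq_pow (p := p) u n, h, zero_pow (pow_ne_zero n (Fact.out : p.Prime).ne_zero)])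

omit [Fact (¬ IsUnit (p : integerC F))] [IsAdicComplete (Ideal.span {(p : integerC F)}) (integerC F)] in
/-- **Level `n`: `σ(u_n) = ζ_{pⁿ}^k · u_n` with `k < pⁿ`** for `σ` fixing `u` (`σ(u_n)/u_n` is a `pⁿ`-th root of unity, and
`ζ_{pⁿ} = epsRaw p n` is primitive). [cite: FontaineAsterisque223III, Exp. II §1.2.2] -/
theorem exists_smul_rootSeq_eq (σ : absoluteGaloisGroup F) (hu : u ≠ 0) (hσu : σ • u = u) (n : ℕ) :
    ∃ k < p ^ n, σ • rootSeq p u n = epsRaw p n ^ k * rootSeq p u n := by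
  haveI : NeZero (p ^ n) := ⟨pow_ne_zero n (Fact.out : p.Prime).ne_zero⟩
  have hn := rootSeq_ne_zero (p := p) hu n
  have hroot : (σ • rootSeq p u n * (rootSeq p u n)⁻¹) ^ p ^ n = 1 := by
    rw [mul_pow, inv_pow, ← smul_pow', rootSeq_pow, hσu, ← rootSeq_pow (p := p) u n, mul_inv_cancel₀ (pow_ne_zero _ hn)]
  obtain ⟨k, hk, hζ⟩ := (isPrimitiveRoot_epsRaw (F := F) (p := p) n).eq_pow_of_pow_eq_one hroot
  exact ⟨k, hk, by rw [hζ, mul_assoc, inv_mul_cancel₀ hn, mul_one]⟩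

omit [Fact (¬ IsUnit (p : integerC F))] [IsAdicComplete (Ideal.span {(p : integerC F)}) (integerC F)] in
/-- **The level-`n` Kummer exponent** `k_n(σ) < pⁿ` of `σ` on the root system of `u`: `σ(u_n) = ζ_{pⁿ}^{k_n(σ)} u_n`.
[cite: FontaineAsterisque223III, Exp. II §1.2.2] -/
def kummerExpLevel (σ : absoluteGaloisGroup F) (hu : u ≠ 0) (hσu : σ • u = u) (n : ℕ) : ℕ :=
  Classical.choose (exists_smul_rootSeq_eq (p := p) σ hu hσu n)

omit [Fact (¬ IsUnit (p : integerC F))] [IsAdicComplete (Ideal.span {(p : integerC F)}) (integerC F)] in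
/-- `k_n(σ) < pⁿ`. [cite: FontaineAsterisque223III, Exp. II §1.2.2] -/
theorem kummerExpLevel_lt (σ : absoluteGaloisGroup F) (hu : u ≠ 0) (hσu : σ • u = u) (n : ℕ) :
    kummerExpLevel (p := p) σ hu hσu n < p ^ n :=
  (Classical.choose_spec (exists_smul_rootSeq_eq (p := p) σ hu hσu n)).1

omit [Fact (¬ IsUnit (p : integerC F))] [IsAdicComplete (Ideal.span {(p : integerC F)}) (integerC F)] in
/-- `σ(u_n) = ζ_{pⁿ}^{k_n(σ)} u_n`. [cite: FontaineAsterisque223III, Exp. II §1.2.2] -/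
theorem smul_rootSeq (σ : absoluteGaloisGroup F) (hu : u ≠ 0) (hσu : σ • u = u) (n : ℕ) :
    σ • rootSeq p u n = epsRaw p n ^ kummerExpLevel (p := p) σ hu hσu n * rootSeq p u n :=
  (Classical.choose_spec (exists_smul_rootSeq_eq (p := p) σ hu hσu n)).2

omit [Fact (¬ IsUnit (p : integerC F))] [IsAdicComplete (Ideal.span {(p : integerC F)}) (integerC F)] in
/-- **Compatibility `k_{n+1}(σ) ≡ k_n(σ) (mod pⁿ)`** (raise `σ(u_{n+1}) = ζ_{p^{n+1}}^{k_{n+1}} u_{n+1}` to the `p`-th power).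
[cite: FontaineAsterisque223III, Exp. II §1.2.2] -/
theorem kummerExpLevel_succ_mod (σ : absoluteGaloisGroup F) (hu : u ≠ 0) (hσu : σ • u = u) (n : ℕ) :
    kummerExpLevel (p := p) σ hu hσu (n + 1) % p ^ n = kummerExpLevel (p := p) σ hu hσu n := by
  have h1 : (σ • rootSeq p u (n + 1)) ^ p = (epsRaw p (n + 1) ^ kummerExpLevel (p := p) σ hu hσu (n + 1) *
      rootSeq p u (n + 1)) ^ p := by rw [smul_rootSeq (p := p) σ hu hσu (n + 1)]
  rw [← smul_pow', rootSeq_succ_pow, mul_pow, rootSeq_succ_pow, ← pow_mul,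
    mul_comm (kummerExpLevel (p := p) σ hu hσu (n + 1)) p, pow_mul, epsRaw_succ_pow,
    smul_rootSeq σ hu hσu n, pow_eq_pow_mod_of_pow_eq_one (epsRaw_pow n) (kummerExpLevel (p := p) σ hu hσu (n + 1))] at h1
  have h2 := mul_right_cancel₀ (rootSeq_ne_zero (p := p) hu n) h1
  exact ((isPrimitiveRoot_epsRaw (F := F) (p := p) n).pow_inj (Nat.mod_lt _ (pow_pos (Fact.out : p.Prime).pos n))
    (kummerExpLevel_lt σ hu hσu n) h2.symm)

omit [Fact (¬ IsUnit (p : integerC F))] [IsAdicComplete (Ideal.span {(p : integerC F)}) (integerC F)] in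
/-- Compatibility across levels: `k_n(σ) ≡ k_m(σ) (mod p^m)` for `m ≤ n`. [cite: FontaineAsterisque223III, Exp. II §1.2.2] -/
theorem kummerExpLevel_mod (σ : absoluteGaloisGroup F) (hu : u ≠ 0) (hσu : σ • u = u) {m n : ℕ} (h : m ≤ n) :
    kummerExpLevel (p := p) σ hu hσu n % p ^ m = kummerExpLevel (p := p) σ hu hσu m := by
  induction n, h using Nat.le_induction with
  | base => exact Nat.mod_eq_of_lt (kummerExpLevel_lt σ hu hσu m)
  | succ n hmn ih =>
    have h1 : kummerExpLevel (p := p) σ hu hσu (n + 1) ≡ kummerExpLevel (p := p) σ hu hσu n [MOD p ^ m] :=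
      Nat.ModEq.of_dvd (pow_dvd_pow p hmn) ((Nat.mod_modEq _ _).symm.trans
        (by rw [kummerExpLevel_succ_mod σ hu hσu n]))
    rw [← ih]; exact h1

omit [Fact (¬ IsUnit (p : integerC F))] [IsAdicComplete (Ideal.span {(p : integerC F)}) (integerC F)] in
/-- The compatible family of ring maps `ℤ[X] → ℤ/pⁿ`, `X ↦ k_n(σ)`, whose limit is the Kummer exponent. [folklore] -/
private def expHom (σ : absoluteGaloisGroup F) (hu : u ≠ 0) (hσu : σ • u = u) (n : ℕ) : Polynomial ℤ →+* ZMod (p ^ n) :=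
  (Polynomial.aeval (R := ℤ) ((kummerExpLevel (p := p) σ hu hσu n : ℕ) : ZMod (p ^ n))).toRingHom

omit [Fact (¬ IsUnit (p : integerC F))] [IsAdicComplete (Ideal.span {(p : integerC F)}) (integerC F)] in
/-- Compatibility of the family `expHom`. [folklore] -/
private theorem expHom_compat (σ : absoluteGaloisGroup F) (hu : u ≠ 0) (hσu : σ • u = u) (m n : ℕ) (h : m ≤ n) :
    (ZMod.castHom (pow_dvd_pow p h) (ZMod (p ^ m))).comp (expHom (p := p) σ hu hσu n) = expHom (p := p) σ hu hσu m := by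
  refine Polynomial.ringHom_ext (fun z => by simp [expHom]) ?_
  rw [RingHom.comp_apply, expHom, expHom, AlgHom.toRingHom_eq_coe, AlgHom.toRingHom_eq_coe, RingHom.coe_coe,
    RingHom.coe_coe, Polynomial.aeval_X, Polynomial.aeval_X, map_natCast, ZMod.natCast_eq_natCast_iff',
    Nat.mod_eq_of_lt (kummerExpLevel_lt σ hu hσu m)]
  exact kummerExpLevel_mod σ hu hσu h

omit [Fact (¬ IsUnit (p : integerC F))] [IsAdicComplete (Ideal.span {(p : integerC F)}) (integerC F)] in
/-- **The Kummer exponent `a(σ) ∈ ℤ_p`** of `σ` (fixing `u`) on the root system of `u`: the `p`-adic integer with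
`a(σ) ≡ k_n(σ) (mod pⁿ)` for all `n` — the value at `σ` of the Kummer cocycle of `u` in the basis `ε` of `ℤ_p(1)`.
[cite: FontaineAsterisque223III, Exp. II §1.2.2] [cite: BlochKato1990, Ex. 3.10.1] -/
def kummerExp (σ : absoluteGaloisGroup F) (hu : u ≠ 0) (hσu : σ • u = u) : ℤ_[p] :=
  PadicInt.lift (expHom_compat (p := p) σ hu hσu) Polynomial.X

omit [Fact (¬ IsUnit (p : integerC F))] [IsAdicComplete (Ideal.span {(p : integerC F)}) (integerC F)] in
/-- `a(σ) mod pⁿ = k_n(σ)`. [cite: FontaineAsterisque223III, Exp. II §1.2.2] -/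
theorem toZModPow_kummerExp (σ : absoluteGaloisGroup F) (hu : u ≠ 0) (hσu : σ • u = u) (n : ℕ) :
    PadicInt.toZModPow n (kummerExp (p := p) σ hu hσu) = (kummerExpLevel (p := p) σ hu hσu n : ZMod (p ^ n)) := by
  have h := RingHom.congr_fun (PadicInt.lift_spec (expHom_compat (p := p) σ hu hσu) n) Polynomial.X
  rw [RingHom.comp_apply] at h
  rw [kummerExp, h, expHom, AlgHom.toRingHom_eq_coe, RingHom.coe_coe, Polynomial.aeval_X]

omit [Fact (¬ IsUnit (p : integerC F))] [IsAdicComplete (Ideal.span {(p : integerC F)}) (integerC F)] in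
/-- `(a(σ) mod pⁿ).val = k_n(σ)`. [cite: FontaineAsterisque223III, Exp. II §1.2.2] -/
theorem toZModPow_kummerExp_val (σ : absoluteGaloisGroup F) (hu : u ≠ 0) (hσu : σ • u = u) (n : ℕ) :
    (PadicInt.toZModPow n (kummerExp (p := p) σ hu hσu)).val = kummerExpLevel (p := p) σ hu hσu n := by
  haveI : NeZero (p ^ n) := ⟨pow_ne_zero n (Fact.out : p.Prime).ne_zero⟩
  rw [toZModPow_kummerExp, ZMod.val_natCast, Nat.mod_eq_of_lt (kummerExpLevel_lt σ hu hσu n)]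

omit [Fact (¬ IsUnit (p : integerC F))] [IsAdicComplete (Ideal.span {(p : integerC F)}) (integerC F)] in
/-- `σ` on the root system in `𝒪_{ℂ_F}`: `σ(u_n) = ζ_{pⁿ}^{k_n(σ)} u_n`. [cite: FontaineAsterisque223III, Exp. II §1.2.2] -/
theorem galInt_rootC (σ : absoluteGaloisGroup F) (hu : u ≠ 0) (hu1 : ‖u‖ ≤ 1) (hσu : σ • u = u) (n : ℕ) :
    galInt σ (rootC p u hu1 n) = epsC p n ^ kummerExpLevel (p := p) σ hu hσu n * rootC p u hu1 n := by
  refine Subtype.ext ?_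
  rw [coe_galInt, Subring.coe_mul, SubmonoidClass.coe_pow]
  change σ • ((rootSeq p u n : NormedAlgClosure F) : CompletedAlgClosure F) =
    ((epsRaw p n : NormedAlgClosure F) : CompletedAlgClosure F) ^ kummerExpLevel (p := p) σ hu hσu n *
      ((rootSeq p u n : NormedAlgClosure F) : CompletedAlgClosure F)
  rw [CompletedAlgClosure.smul_coe, smul_rootSeq σ hu hσu n, UniformSpace.Completion.coe_mul]
  congr 1
  exact map_pow (UniformSpace.Completion.coeRingHom : NormedAlgClosure F →+* CompletedAlgClosure F) _ _

omit [IsAdicComplete (Ideal.span {(p : integerC F)}) (integerC F)] in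
/-- **`σ♭(ũ) = ε^{a(σ)} · ũ` in `𝒪_{ℂ_F}♭`** for every `σ ∈ Γ_F` fixing `u` (`0 < |u| ≤ 1`): the hypothesis `hσv` of
`gal_kummerUnitLog` is DISCHARGED by the Kummer exponent. [cite: FontaineAsterisque223III, Exp. II §1.2.2] [cite: BlochKato1990, Ex. 3.10.1] -/
theorem galTilt_rootTilt (σ : absoluteGaloisGroup F) (hu : u ≠ 0) (hu1 : ‖u‖ ≤ 1) (hσu : σ • u = u) :
    galTilt σ (rootTilt p u hu1) = epsPow (kummerExp (p := p) σ hu hσu) * rootTilt p u hu1 := by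
  refine Perfection.ext fun n => ?_
  change PreTilt.coeff n (galTilt σ (rootTilt p u hu1)) = PreTilt.coeff n (epsPow (kummerExp (p := p) σ hu hσu) * rootTilt p u hu1)
  rw [coeff_galTilt, map_mul, coeff_rootTilt, coeff_epsPow, galModP_mk, galInt_rootC σ hu hu1 hσu, map_mul, map_pow,
    map_pow, toZModPow_kummerExp_val]

/-- **MAIN, unconditional form — `σ(ℓ_u) = ℓ_u + a(σ)·t`** for every `σ ∈ Γ_F` fixing the unit `u` (`0 < |u| ≤ 1`), with
`ℓ_u = kummerUnitLog (rootTilt u) u` and `a(σ) = kummerExp σ` the Kummer cocycle of `u` in the basis `ε`: the Kummer cocycle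
of `u` with values in `ℤ_p(1) ⊗ B_dR⁺ = t·B_dR⁺` is the coboundary of the explicit element `ℓ_u ∈ Fil¹B_dR⁺`.
[cite: BlochKato1990, Ex. 3.10.1] [cite: Kato1993LNM1553, Ch. II §1.4.4] [cite: FontaineAsterisque223III, Exp. II §1.5.4] -/
theorem gal_kummerUnitLog_eq (σ : absoluteGaloisGroup F) (hu : u ≠ 0) (hu1 : ‖u‖ ≤ 1) (hσu : σ • u = u) :
    gal F p σ (kummerUnitLog hp hF (rootTilt p u hu1) u hu (coe_untilt_rootTilt u hu1) : BdRPlusTop F p) =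
      kummerUnitLog hp hF (rootTilt p u hu1) u hu (coe_untilt_rootTilt u hu1) +
        of F p (qpToBdR (kummerExp (p := p) σ hu hσu : ℚ_[p]) * tBdR) :=
  gal_kummerUnitLog_rootTilt hp hF σ hu hu1 (kummerExp (p := p) σ hu hσu) (galTilt_rootTilt σ hu hu1 hσu) hσu

end Exponent

end BdRPlusTop

end Literature.NumberTheory.PAdicHodge

end
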